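import Summits.CriticalPhenomena.Ising3DConformalLimit.Theses.PerfectScreening
import Summits.CriticalPhenomena.Ising3DConformalLimit.Theses.PlantedPinning
import Summits.CriticalPhenomena.Ising3DConformalLimit.Theses.LeeYangGap
import Summits.CriticalPhenomena.Ising3DConformalLimit.Theses.SubPtolemyInterlacing
import Summits.CriticalPhenomena.Ising3DConformalLimit.Theses.EnergyNotSigmaSquared
import Summits.CriticalPhenomena.Ising3DConformalLimit.Theses.HyperoctahedralRP
import Summits.CriticalPhenomena.Ising3DConformalLimit.Theorems.PerfectScreeningMoebiusLimitExistsTwoLeaf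
import Summits.CriticalPhenomena.Ising3DConformalLimit.Theorems.PlantedPinningMoebiusLimitExistsWardDoor
import Summits.CriticalPhenomena.Ising3DConformalLimit.Theorems.PlantedPinningMoebiusLimitExistsWardDoorTight
import Summits.CriticalPhenomena.Ising3DConformalLimit.Theorems.PlantedPinningMoebiusLimitExistsWardLowLevels
import Summits.CriticalPhenomena.Ising3DConformalLimit.Theorems.PlantedPinningMoebiusLimitExistsWardOfWardDir
import Summits.CriticalPhenomena.Ising3DConformalLimit.Theorems.LeeYangGapMoebiusLimitExistsLatticeK1Door
import Literature.Probability.LatticeModels.SCTWardIdentity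
import Literature.MathematicalPhysics.QuantumFieldTheory.PointwiseOSReconstruction
import HarnessLib

/-!
# One generator, even levels: crux `MoebiusLimitExists` (stmt-CriticalPhenomena-1344) ⟺ item 1981 ∧ 7⁗, item 1982 ⟺ the `K_{e₀}` upgrade
(line `Sketch` v11/v12, lead prover-line-stmt-CriticalPhenomena-1344-c18-0; THEOREM-ONLY, `--supports stmt-CriticalPhenomena-1344`)

Skeleton v11 (lead c17) stripped the provably free content out of the Ward-form residual 7″ (`∀ n, SCTWardWeak S Δ n` for every
interacting open-window Ising₃ limit; tightness p149203) and v12 (this lead) has its two free stubs landed: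

* W0 `MoebiusLimitExistsSketchV11.stub_wardLowLevels` (p154617): for every normalised Euclidean scale-covariant pointwise limit of
  `criticalCorr 3`, the weak special-conformal Ward identities hold at the levels `n < 4` and at all odd levels;
* W1 `MoebiusLimitExistsSketchV11.stub_wardOfWardDir` (p154558): at one level, `O(3)` invariance turns the weak `K_{b₀}` identity for ONE
  `b₀ ≠ 0` into the weak `K_b` identity for every `b`.

This file records the consequences, all kernel-checked compositions (no `sorry`, no definitions):

* `sctWardWeak_all_of_k1EvenGeFour` — for a normalised Euclidean scale-covariant pointwise limit of `criticalCorr 3`, the weak Ward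
  identity for the SINGLE generator `K_{e₀}` (`e₀ = EuclideanSpace.single 0 1`) at the EVEN levels `n ≥ 4` already gives
  `∀ n, SCTWardWeak S Δ n` — the infinitesimal form of "the Euclidean group and one special conformal transformation generate the
  Möbius group"; with the Ward door, `isMoebiusCovariant_of_limit_of_k1EvenGeFour` and the clean dichotomy
  `k1EvenGeFour_iff_isMoebiusCovariant_of_limit` (for such limits: `K_{e₀}`-Ward at even `n ≥ 4` ⟺ `IsMoebiusCovariant Δ S`);
* **item 1982 ⟺ the bare `K_{e₀}` upgrade** (`inversionUpgradeNormalised_iff_k1WardUpgrade`) and **⟺ its asymptotic LATTICE form**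
  (`inversionUpgradeNormalised_iff_latticeK1WardUpgrade`, through `MoebiusLimitExistsLatticeWard.k1Ward_iff_latticeK1Ward`, p153032):
  every normalised non-degenerate Euclidean scale-covariant limit datum `(ρ, Δ)` of `criticalCorr 3` makes the rescaled critical
  correlators satisfy `∫ ρ(δ)ⁿ ⟨σ_[x₁/δ]⋯σ_[xₙ/δ]⟩⁺_{β_c} 𝒦ᵀ_{e₀}φ(x) dx → 0` (`δ → 0⁺`) at even `n ≥ 4` — no limit object in the conclusion;
* **TIGHTNESS of v11/v12: crux ⟺ 1981 ∧ 7⁗** (`MoebiusLimitExists_iff_existence_and_k1WardStrict`; 7⁗ = the registered residual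
  `stub_interiorWardK1EvenGeFour` with its idle window / `U₄` / OS / clustering premises) and **crux ⟺ 1981 ∧ 7⁗_lat**
  (`MoebiusLimitExists_iff_existence_and_latticeK1WardStrict`), plus the PlantedPinning / LeeYangGap / SubPtolemyInterlacing /
  EnergyNotSigmaSquared spellings of the sufficiency direction.  So the census of kernel-checked equivalent residuals of crux 1344 reads
  `crux ⟺ 1981 ∧ X`, X ∈ {1982, 7′, 7″, 7‴, 7⁗, 7⁗_lat, 4840, 4671}.

References: Di Francesco–Mathieu–Sénéchal 1997 §4.1 (4.18)–(4.19), §4.3.1 (4.51)–(4.56) [FrancescoMathieuSenechal1997];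
Duminil-Copin, ICM 2022 §8.4 [DuminilCopinICM2022].
-/

noncomputable section

namespace Summit.CriticalPhenomena.Ising3DConformalLimit.MoebiusLimitExistsK1Door

open Filter Topology MeasureTheory
open Literature.Probability.LatticeModels Literature.MathematicalPhysics.QuantumFieldTheory
open Summit.CriticalPhenomena.Ising3DConformalLimit.Theses
open Summit.CriticalPhenomena.Ising3DConformalLimit.MoebiusLimitExistsSketchV11 (stub_wardLowLevels stub_wardOfWardDir)
open Summit.CriticalPhenomena.Ising3DConformalLimit.MoebiusLimitExistsWardDoor
  (sctWardWeak_three_iff isMoebiusCovariant_of_limit_of_sctWardWeak continuousOn_of_limit sctWardWeak_of_moebius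
    MoebiusLimitExists_of_existence_of_wardStrict inversionUpgradeNormalised_iff_wardUpgrade wardStrict_of_MoebiusLimitExists)
open Summit.CriticalPhenomena.Ising3DConformalLimit.MoebiusLimitExistsOnlyInteraction
  (existsScaleCovariantLimit_of_MoebiusLimitExists)
open Summit.CriticalPhenomena.Ising3DConformalLimit.MoebiusLimitExistsLatticeWard (k1Ward_iff_latticeK1Ward)

/-! ## One generator at the even levels `≥ 4` gives every weak Ward identity -/

/-- The chosen generator `e₀ = EuclideanSpace.single 0 1` is non-zero. [folklore] -/
theorem single_zero_one_ne_zero : (EuclideanSpace.single 0 1 : EuclideanSpace ℝ (Fin 3)) ≠ 0 := fun h => by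
  simpa using congrArg (fun v : EuclideanSpace ℝ (Fin 3) => v 0) h

/-- **From the single-generator identity at even levels `≥ 4` to all weak special-conformal Ward identities**, for a normalised
Euclidean scale-covariant pointwise limit of the critical `ℤ³` correlators: levels `n < 4` and odd `n` are free (W0, p154617), and at
each remaining level `O(3)` invariance turns the `K_{e₀}` identity into every `K_b` identity (W1, p154558).
[cite: FrancescoMathieuSenechal1997, §4.3.1 (4.51)–(4.54)] -/
theorem sctWardWeak_all_of_k1EvenGeFour {ρ : ℝ → ℝ} {Δ : ℝ} {S : CorrFamily 3}
    (hlim : HasPointwiseScalingLimit (criticalCorr 3) ρ S) (hnorm : ∀ n z, z ∉ NonCoincident 3 n → S n z = 0)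
    (heuc : IsEuclideanInvariant S) (hsc : IsScaleCovariant Δ S)
    (hK1 : ∀ n, 4 ≤ n → Even n → ∀ (φ : (Fin n → EuclideanSpace ℝ (Fin 3)) → ℝ),
        ContDiff ℝ ((⊤ : ℕ∞) : WithTop ℕ∞) φ → HasCompactSupport φ → tsupport φ ⊆ NonCoincident 3 n →
        ∫ x, S n x * ((2 * Δ - 6) * (∑ i, inner ℝ (EuclideanSpace.single 0 1 : EuclideanSpace ℝ (Fin 3)) (x i)) * φ x +
          fderiv ℝ φ x (fun i => ‖x i‖ ^ 2 • (EuclideanSpace.single 0 1 : EuclideanSpace ℝ (Fin 3)) -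
            (2 * inner ℝ (EuclideanSpace.single 0 1 : EuclideanSpace ℝ (Fin 3)) (x i)) • x i)) = 0) :
    ∀ n, SCTWardWeak S Δ n := fun n => by
  rcases Nat.lt_or_ge n 4 with hn4 | hn4
  · exact stub_wardLowLevels ρ Δ S hlim hnorm heuc hsc n (Or.inl hn4)
  rcases Nat.even_or_odd n with he | ho
  · exact (sctWardWeak_three_iff S Δ n).2
      (stub_wardOfWardDir n (S n) Δ (EuclideanSpace.single 0 1) single_zero_one_ne_zero (heuc.2 n) (hK1 n hn4 he))
  · exact stub_wardLowLevels ρ Δ S hlim hnorm heuc hsc n (Or.inr ho)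

/-- **The `K_{e₀}` identities at even levels `≥ 4` integrate to Möbius covariance** for a normalised Euclidean scale-covariant
pointwise limit of `criticalCorr 3` (previous theorem ∘ the Ward door `isMoebiusCovariant_of_limit_of_sctWardWeak`, item 5357).
[cite: FrancescoMathieuSenechal1997, §4.3.1 eq. (4.62)] -/
theorem isMoebiusCovariant_of_limit_of_k1EvenGeFour {ρ : ℝ → ℝ} {Δ : ℝ} {S : CorrFamily 3}
    (hlim : HasPointwiseScalingLimit (criticalCorr 3) ρ S) (hnorm : ∀ n z, z ∉ NonCoincident 3 n → S n z = 0)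
    (heuc : IsEuclideanInvariant S) (hsc : IsScaleCovariant Δ S)
    (hK1 : ∀ n, 4 ≤ n → Even n → ∀ (φ : (Fin n → EuclideanSpace ℝ (Fin 3)) → ℝ),
        ContDiff ℝ ((⊤ : ℕ∞) : WithTop ℕ∞) φ → HasCompactSupport φ → tsupport φ ⊆ NonCoincident 3 n →
        ∫ x, S n x * ((2 * Δ - 6) * (∑ i, inner ℝ (EuclideanSpace.single 0 1 : EuclideanSpace ℝ (Fin 3)) (x i)) * φ x +
          fderiv ℝ φ x (fun i => ‖x i‖ ^ 2 • (EuclideanSpace.single 0 1 : EuclideanSpace ℝ (Fin 3)) -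
            (2 * inner ℝ (EuclideanSpace.single 0 1 : EuclideanSpace ℝ (Fin 3)) (x i)) • x i)) = 0) :
    IsMoebiusCovariant Δ S :=
  isMoebiusCovariant_of_limit_of_sctWardWeak hlim hnorm heuc (sctWardWeak_all_of_k1EvenGeFour hlim hnorm heuc hsc hK1)

/-- **Conversely, Möbius covariance gives the `K_{e₀}` identities** (all levels, all generators: `sctWardWeak_of_moebius`, the landed
converse door F2 ∘ F1 ∘ F0, then specialise), for any family continuous off the diagonals. [cite: FrancescoMathieuSenechal1997, §4.3.1 eq. (4.56)] -/
theorem k1EvenGeFour_of_moebius {Δ : ℝ} {S : CorrFamily 3} (hcont : ∀ n, ContinuousOn (S n) (NonCoincident 3 n))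
    (hM : IsMoebiusCovariant Δ S) :
    ∀ n, 4 ≤ n → Even n → ∀ (φ : (Fin n → EuclideanSpace ℝ (Fin 3)) → ℝ),
        ContDiff ℝ ((⊤ : ℕ∞) : WithTop ℕ∞) φ → HasCompactSupport φ → tsupport φ ⊆ NonCoincident 3 n →
        ∫ x, S n x * ((2 * Δ - 6) * (∑ i, inner ℝ (EuclideanSpace.single 0 1 : EuclideanSpace ℝ (Fin 3)) (x i)) * φ x +
          fderiv ℝ φ x (fun i => ‖x i‖ ^ 2 • (EuclideanSpace.single 0 1 : EuclideanSpace ℝ (Fin 3)) -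
            (2 * inner ℝ (EuclideanSpace.single 0 1 : EuclideanSpace ℝ (Fin 3)) (x i)) • x i)) = 0 :=
  fun n _ _ φ hφ hφc hφU =>
    (sctWardWeak_three_iff S Δ n).1 (sctWardWeak_of_moebius hcont hM.isEuclideanInvariant.1 hM.isInversionCovariant n)
      (EuclideanSpace.single 0 1) φ hφ hφc hφU

/-- **Dichotomy-free reading: for normalised Euclidean scale-covariant pointwise limits of `criticalCorr 3`, the single-generator
even-level weak Ward identities ARE Möbius covariance.** [cite: FrancescoMathieuSenechal1997, §4.3.1 (4.51)–(4.56)] -/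
theorem k1EvenGeFour_iff_isMoebiusCovariant_of_limit {ρ : ℝ → ℝ} {Δ : ℝ} {S : CorrFamily 3}
    (hlim : HasPointwiseScalingLimit (criticalCorr 3) ρ S) (hnorm : ∀ n z, z ∉ NonCoincident 3 n → S n z = 0)
    (heuc : IsEuclideanInvariant S) (hsc : IsScaleCovariant Δ S) :
    (∀ n, 4 ≤ n → Even n → ∀ (φ : (Fin n → EuclideanSpace ℝ (Fin 3)) → ℝ),
        ContDiff ℝ ((⊤ : ℕ∞) : WithTop ℕ∞) φ → HasCompactSupport φ → tsupport φ ⊆ NonCoincident 3 n →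
        ∫ x, S n x * ((2 * Δ - 6) * (∑ i, inner ℝ (EuclideanSpace.single 0 1 : EuclideanSpace ℝ (Fin 3)) (x i)) * φ x +
          fderiv ℝ φ x (fun i => ‖x i‖ ^ 2 • (EuclideanSpace.single 0 1 : EuclideanSpace ℝ (Fin 3)) -
            (2 * inner ℝ (EuclideanSpace.single 0 1 : EuclideanSpace ℝ (Fin 3)) (x i)) • x i)) = 0) ↔
      IsMoebiusCovariant Δ S :=
  ⟨isMoebiusCovariant_of_limit_of_k1EvenGeFour hlim hnorm heuc hsc, k1EvenGeFour_of_moebius (continuousOn_of_limit hlim)⟩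

/-! ## Item 1982 ⟺ the bare `K_{e₀}` upgrade ⟺ its asymptotic lattice form -/

/-- **Item 1982 ⟺ the bare single-generator even-level Ward upgrade**: every normalised non-degenerate Euclidean scale-covariant
pointwise limit of the critical `ℤ³` correlators is inversion covariant iff every such limit satisfies the weak `K_{e₀}` identities at
the even levels `n ≥ 4`. [cite: FrancescoMathieuSenechal1997, §4.3.1 eq. (4.62)] -/
theorem inversionUpgradeNormalised_iff_k1WardUpgrade : Summit.CriticalPhenomena.Ising3DConformalLimit.Theses.HyperoctahedralRP.InversionUpgradeNormalised ↔ (∀ (ρ : ℝ → ℝ) (Δ : ℝ) (S : Literature.Probability.LatticeModels.CorrFamily 3), (∀ δ ∈ Set.Ioc (0:ℝ) 1, 0 < ρ δ) → Literature.Probability.LatticeModels.HasPointwiseScalingLimit (Literature.Probability.LatticeModels.criticalCorr 3) ρ S → (∀ n z, z ∉ Literature.Probability.LatticeModels.NonCoincident 3 n → S n z = 0) → Literature.Probability.LatticeModels.IsNondegenerateTwoPoint S → Literature.Probability.LatticeModels.IsEuclideanInvariant S → Literature.Probability.LatticeModels.IsScaleCovariant Δ S → ∀ n, 4 ≤ n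 → Even n → ∀ (φ : (Fin n → EuclideanSpace ℝ (Fin 3)) → ℝ), ContDiff ℝ ((⊤ : ℕ∞) : WithTop ℕ∞) φ → HasCompactSupport φ → tsupport φ ⊆ Literature.Probability.LatticeModels.NonCoincident 3 n → MeasureTheory.integral MeasureTheory.volume (fun x => S n x * ((2 * Δ - 6) * (∑ i, inner ℝ (EuclideanSpace.single 0 1 : EuclideanSpace ℝ (Fin 3)) (x i)) * φ x + fderiv ℝ φ x (fun i => ‖x i‖ ^ 2 • (EuclideanSpace.single 0 1 : EuclideanSpace ℝ (Fin 3)) - (2 * inner ℝ (EuclideanSpace.single 0 1 : EuclideanSpace ℝ (Fin 3)) (x i)) • x i))) = 0) :=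
  ⟨fun h ρ Δ S hρ hlim hnorm hnd heuc hsc =>
      k1EvenGeFour_of_moebius (continuousOn_of_limit hlim) ⟨heuc, hsc, h ρ Δ S hρ hlim hnorm hnd heuc hsc⟩,
    fun hK ρ Δ S hρ hlim hnorm hnd heuc hsc =>
      (isMoebiusCovariant_of_limit_of_k1EvenGeFour hlim hnorm heuc hsc (hK ρ Δ S hρ hlim hnorm hnd heuc hsc)).isInversionCovariant⟩

/-- **Item 1982 ⟺ the asymptotic LATTICE single-generator even-level Ward identities** along every normalised non-degenerate Euclidean
scale-covariant limit datum `(ρ, Δ)`: `∫ ρ(δ)ⁿ ⟨σ_[x₁/δ]⋯σ_[xₙ/δ]⟩⁺_{β_c} 𝒦ᵀ_{e₀}φ(x) dx → 0` as `δ → 0⁺` for even `n ≥ 4` and every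
smooth `φ` compactly supported off the diagonals (`k1Ward_iff_latticeK1Ward`, p153032).  The conclusion mentions no limit object.
[cite: FrancescoMathieuSenechal1997, §4.3.1 (4.51)–(4.54)] -/
theorem inversionUpgradeNormalised_iff_latticeK1WardUpgrade :
    HyperoctahedralRP.InversionUpgradeNormalised ↔
      (∀ (ρ : ℝ → ℝ) (Δ : ℝ) (S : CorrFamily 3), (∀ δ ∈ Set.Ioc (0:ℝ) 1, 0 < ρ δ) →
        HasPointwiseScalingLimit (criticalCorr 3) ρ S → (∀ n z, z ∉ NonCoincident 3 n → S n z = 0) →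
        IsNondegenerateTwoPoint S → IsEuclideanInvariant S → IsScaleCovariant Δ S →
        ∀ n, 4 ≤ n → Even n → ∀ (φ : (Fin n → EuclideanSpace ℝ (Fin 3)) → ℝ),
          ContDiff ℝ ((⊤ : ℕ∞) : WithTop ℕ∞) φ → HasCompactSupport φ → tsupport φ ⊆ NonCoincident 3 n →
          Tendsto (fun δ => ∫ x, rescaledCorrelator (criticalCorr 3) ρ n δ x *
              ((2 * Δ - 6) * (∑ i, inner ℝ (EuclideanSpace.single 0 1 : EuclideanSpace ℝ (Fin 3)) (x i)) * φ x +
                fderiv ℝ φ x (fun i => ‖x i‖ ^ 2 • (EuclideanSpace.single 0 1 : EuclideanSpace ℝ (Fin 3)) -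
                  (2 * inner ℝ (EuclideanSpace.single 0 1 : EuclideanSpace ℝ (Fin 3)) (x i)) • x i)))
            (𝓝[>] (0:ℝ)) (𝓝 0)) := by
  rw [inversionUpgradeNormalised_iff_k1WardUpgrade]
  refine forall_congr' fun ρ => forall_congr' fun Δ => forall_congr' fun S => forall_congr' fun _ =>
    forall_congr' fun hlim => ?_
  exact forall_congr' fun _ => forall_congr' fun _ => forall_congr' fun _ => forall_congr' fun _ =>
    k1Ward_iff_latticeK1Ward ρ Δ S hlim

/-! ## The crux ⟺ item 1981 ∧ 7⁗ (the registered residual of skeleton v11/v12) ⟺ item 1981 ∧ 7⁗_lat -/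

/-- **The crux implies 7⁗** (crux ⇒ 7″, p149203, then specialise to `b = e₀` and even `n ≥ 4`): the residual is necessary.
[cite: FrancescoMathieuSenechal1997, §4.3.1 eq. (4.56)] -/
theorem k1WardStrict_of_MoebiusLimitExists (h : PerfectScreening.MoebiusLimitExists) :
    ∀ (ρ : ℝ → ℝ) (Δ : ℝ) (S : CorrFamily 3), (∀ δ ∈ Set.Ioc (0:ℝ) 1, 0 < ρ δ) →
      HasPointwiseScalingLimit (criticalCorr 3) ρ S → (∀ n z, z ∉ NonCoincident 3 n → S n z = 0) →
      IsNondegenerateTwoPoint S → IsEuclideanInvariant S → IsScaleCovariant Δ S →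
      1 / 2 < Δ → Δ ≤ 3 / 4 → HasNontrivialU4 S →
      (∀ τ : Fin 3, PointwiseOSReconstruction τ S) →
      (∀ (n m : ℕ) (x : Fin n → EuclideanSpace ℝ (Fin 3)) (y : Fin m → EuclideanSpace ℝ (Fin 3))
        (v : EuclideanSpace ℝ (Fin 3)), v ≠ 0 →
        Tendsto (fun t : ℝ => S (n + m) (Fin.append x (fun j => y j + t • v)) - S n x * S m y)
          atTop (𝓝 0)) →
      ∀ n, 4 ≤ n → Even n → ∀ (φ : (Fin n → EuclideanSpace ℝ (Fin 3)) → ℝ),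
        ContDiff ℝ ((⊤ : ℕ∞) : WithTop ℕ∞) φ → HasCompactSupport φ → tsupport φ ⊆ NonCoincident 3 n →
        ∫ x, S n x * ((2 * Δ - 6) * (∑ i, inner ℝ (EuclideanSpace.single 0 1 : EuclideanSpace ℝ (Fin 3)) (x i)) * φ x +
          fderiv ℝ φ x (fun i => ‖x i‖ ^ 2 • (EuclideanSpace.single 0 1 : EuclideanSpace ℝ (Fin 3)) -
            (2 * inner ℝ (EuclideanSpace.single 0 1 : EuclideanSpace ℝ (Fin 3)) (x i)) • x i)) = 0 :=
  fun ρ Δ S hρ hlim hnorm hnd heuc hsc hlt hle hU4 hos hcl n _ _ φ hφ hφc hφU =>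
    (sctWardWeak_three_iff S Δ n).1 (wardStrict_of_MoebiusLimitExists h ρ Δ S hρ hlim hnorm hnd heuc hsc hlt hle hU4 hos hcl n)
      (EuclideanSpace.single 0 1) φ hφ hφc hφU

/-- **The crux ⇐ item 1981 ∧ 7⁗** (the composition of skeleton v12: W0, W1, the Ward door, reduction p139739, two-leaf glue p137285).
[cite: DuminilCopinICM2022, §8.4] -/
theorem MoebiusLimitExists_of_existence_of_k1WardStrict
    (hE : HyperoctahedralRP.ExistsScaleCovariantLimit)
    (h7 : ∀ (ρ : ℝ → ℝ) (Δ : ℝ) (S : CorrFamily 3), (∀ δ ∈ Set.Ioc (0:ℝ) 1, 0 < ρ δ) →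
      HasPointwiseScalingLimit (criticalCorr 3) ρ S → (∀ n z, z ∉ NonCoincident 3 n → S n z = 0) →
      IsNondegenerateTwoPoint S → IsEuclideanInvariant S → IsScaleCovariant Δ S →
      1 / 2 < Δ → Δ ≤ 3 / 4 → HasNontrivialU4 S →
      (∀ τ : Fin 3, PointwiseOSReconstruction τ S) →
      (∀ (n m : ℕ) (x : Fin n → EuclideanSpace ℝ (Fin 3)) (y : Fin m → EuclideanSpace ℝ (Fin 3))
        (v : EuclideanSpace ℝ (Fin 3)), v ≠ 0 →
        Tendsto (fun t : ℝ => S (n + m) (Fin.append x (fun j => y j + t • v)) - S n x * S m y)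
          atTop (𝓝 0)) →
      ∀ n, 4 ≤ n → Even n → ∀ (φ : (Fin n → EuclideanSpace ℝ (Fin 3)) → ℝ),
        ContDiff ℝ ((⊤ : ℕ∞) : WithTop ℕ∞) φ → HasCompactSupport φ → tsupport φ ⊆ NonCoincident 3 n →
        ∫ x, S n x * ((2 * Δ - 6) * (∑ i, inner ℝ (EuclideanSpace.single 0 1 : EuclideanSpace ℝ (Fin 3)) (x i)) * φ x +
          fderiv ℝ φ x (fun i => ‖x i‖ ^ 2 • (EuclideanSpace.single 0 1 : EuclideanSpace ℝ (Fin 3)) -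
            (2 * inner ℝ (EuclideanSpace.single 0 1 : EuclideanSpace ℝ (Fin 3)) (x i)) • x i)) = 0) :
    PerfectScreening.MoebiusLimitExists :=
  MoebiusLimitExists_of_existence_of_wardStrict hE
    fun ρ Δ S hρ hlim hnorm hnd heuc hsc hlt hle hU4 hos hcl =>
      sctWardWeak_all_of_k1EvenGeFour hlim hnorm heuc hsc (h7 ρ Δ S hρ hlim hnorm hnd heuc hsc hlt hle hU4 hos hcl)

/-- **TIGHTNESS of skeleton v11/v12: `MoebiusLimitExists ⟺ ExistsScaleCovariantLimit (1981) ∧ 7⁗`** — the reshape 7″ → 7⁗ drops no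
content and the residual is necessary. [cite: DuminilCopinICM2022, §8.4] -/
theorem MoebiusLimitExists_iff_existence_and_k1WardStrict :
    PerfectScreening.MoebiusLimitExists ↔
      HyperoctahedralRP.ExistsScaleCovariantLimit ∧
      (∀ (ρ : ℝ → ℝ) (Δ : ℝ) (S : CorrFamily 3), (∀ δ ∈ Set.Ioc (0:ℝ) 1, 0 < ρ δ) →
        HasPointwiseScalingLimit (criticalCorr 3) ρ S → (∀ n z, z ∉ NonCoincident 3 n → S n z = 0) →
        IsNondegenerateTwoPoint S → IsEuclideanInvariant S → IsScaleCovariant Δ S →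
        1 / 2 < Δ → Δ ≤ 3 / 4 → HasNontrivialU4 S →
        (∀ τ : Fin 3, PointwiseOSReconstruction τ S) →
        (∀ (n m : ℕ) (x : Fin n → EuclideanSpace ℝ (Fin 3)) (y : Fin m → EuclideanSpace ℝ (Fin 3))
          (v : EuclideanSpace ℝ (Fin 3)), v ≠ 0 →
          Tendsto (fun t : ℝ => S (n + m) (Fin.append x (fun j => y j + t • v)) - S n x * S m y)
            atTop (𝓝 0)) →
        ∀ n, 4 ≤ n → Even n → ∀ (φ : (Fin n → EuclideanSpace ℝ (Fin 3)) → ℝ),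
          ContDiff ℝ ((⊤ : ℕ∞) : WithTop ℕ∞) φ → HasCompactSupport φ → tsupport φ ⊆ NonCoincident 3 n →
          ∫ x, S n x * ((2 * Δ - 6) * (∑ i, inner ℝ (EuclideanSpace.single 0 1 : EuclideanSpace ℝ (Fin 3)) (x i)) * φ x +
            fderiv ℝ φ x (fun i => ‖x i‖ ^ 2 • (EuclideanSpace.single 0 1 : EuclideanSpace ℝ (Fin 3)) -
              (2 * inner ℝ (EuclideanSpace.single 0 1 : EuclideanSpace ℝ (Fin 3)) (x i)) • x i)) = 0) :=
  ⟨fun h => ⟨existsScaleCovariantLimit_of_MoebiusLimitExists h, k1WardStrict_of_MoebiusLimitExists h⟩,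
    fun h => MoebiusLimitExists_of_existence_of_k1WardStrict h.1 h.2⟩

/-- **The crux ⟺ item 1981 ∧ the bare `K_{e₀}` upgrade** (two-leaf glue p137285 with `inversionUpgradeNormalised_iff_k1WardUpgrade`).
[cite: DuminilCopinICM2022, §8.4] -/
theorem MoebiusLimitExists_iff_existence_and_k1WardUpgrade :
    PerfectScreening.MoebiusLimitExists ↔
      HyperoctahedralRP.ExistsScaleCovariantLimit ∧
      (∀ (ρ : ℝ → ℝ) (Δ : ℝ) (S : CorrFamily 3), (∀ δ ∈ Set.Ioc (0:ℝ) 1, 0 < ρ δ) →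
        HasPointwiseScalingLimit (criticalCorr 3) ρ S → (∀ n z, z ∉ NonCoincident 3 n → S n z = 0) →
        IsNondegenerateTwoPoint S → IsEuclideanInvariant S → IsScaleCovariant Δ S →
        ∀ n, 4 ≤ n → Even n → ∀ (φ : (Fin n → EuclideanSpace ℝ (Fin 3)) → ℝ),
          ContDiff ℝ ((⊤ : ℕ∞) : WithTop ℕ∞) φ → HasCompactSupport φ → tsupport φ ⊆ NonCoincident 3 n →
          ∫ x, S n x * ((2 * Δ - 6) * (∑ i, inner ℝ (EuclideanSpace.single 0 1 : EuclideanSpace ℝ (Fin 3)) (x i)) * φ x +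
            fderiv ℝ φ x (fun i => ‖x i‖ ^ 2 • (EuclideanSpace.single 0 1 : EuclideanSpace ℝ (Fin 3)) -
              (2 * inner ℝ (EuclideanSpace.single 0 1 : EuclideanSpace ℝ (Fin 3)) (x i)) • x i)) = 0) := by
  rw [← inversionUpgradeNormalised_iff_k1WardUpgrade]
  exact MoebiusLimitExistsTwoLeaf.MoebiusLimitExists_iff_leaves

/-- **CENSUS LINE: the crux ⟺ item 1981 ∧ 7⁗_lat** — item 1981 plus the asymptotic single-generator even-level LATTICE Ward identities
of the critical `ℤ³` correlators along every interacting open-window limit datum; no limit object in the residual's conclusion.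
[cite: DuminilCopinICM2022, §8.4] -/
theorem MoebiusLimitExists_iff_existence_and_latticeK1WardStrict :
    PerfectScreening.MoebiusLimitExists ↔
      HyperoctahedralRP.ExistsScaleCovariantLimit ∧
      (∀ (ρ : ℝ → ℝ) (Δ : ℝ) (S : CorrFamily 3), (∀ δ ∈ Set.Ioc (0:ℝ) 1, 0 < ρ δ) →
        HasPointwiseScalingLimit (criticalCorr 3) ρ S → (∀ n z, z ∉ NonCoincident 3 n → S n z = 0) →
        IsNondegenerateTwoPoint S → IsEuclideanInvariant S → IsScaleCovariant Δ S →
        1 / 2 < Δ → Δ ≤ 3 / 4 → HasNontrivialU4 S →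
        (∀ τ : Fin 3, PointwiseOSReconstruction τ S) →
        (∀ (n m : ℕ) (x : Fin n → EuclideanSpace ℝ (Fin 3)) (y : Fin m → EuclideanSpace ℝ (Fin 3))
          (v : EuclideanSpace ℝ (Fin 3)), v ≠ 0 →
          Tendsto (fun t : ℝ => S (n + m) (Fin.append x (fun j => y j + t • v)) - S n x * S m y)
            atTop (𝓝 0)) →
        ∀ n, 4 ≤ n → Even n → ∀ (φ : (Fin n → EuclideanSpace ℝ (Fin 3)) → ℝ),
          ContDiff ℝ ((⊤ : ℕ∞) : WithTop ℕ∞) φ → HasCompactSupport φ → tsupport φ ⊆ NonCoincident 3 n →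
          Tendsto (fun δ => ∫ x, rescaledCorrelator (criticalCorr 3) ρ n δ x *
              ((2 * Δ - 6) * (∑ i, inner ℝ (EuclideanSpace.single 0 1 : EuclideanSpace ℝ (Fin 3)) (x i)) * φ x +
                fderiv ℝ φ x (fun i => ‖x i‖ ^ 2 • (EuclideanSpace.single 0 1 : EuclideanSpace ℝ (Fin 3)) -
                  (2 * inner ℝ (EuclideanSpace.single 0 1 : EuclideanSpace ℝ (Fin 3)) (x i)) • x i)))
            (𝓝[>] (0:ℝ)) (𝓝 0)) := by
  rw [MoebiusLimitExists_iff_existence_and_k1WardStrict]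
  refine and_congr_right fun _ => ?_
  refine forall_congr' fun ρ => forall_congr' fun Δ => forall_congr' fun S => forall_congr' fun _ =>
    forall_congr' fun hlim => ?_
  exact forall_congr' fun _ => forall_congr' fun _ => forall_congr' fun _ => forall_congr' fun _ =>
    forall_congr' fun _ => forall_congr' fun _ => forall_congr' fun _ => forall_congr' fun _ =>
    forall_congr' fun _ => k1Ward_iff_latticeK1Ward ρ Δ S hlim

/-! ## Route spellings of the sufficiency direction (byte-identical definientia) -/

/-- Route PlantedPinning: `ExistsScaleCovariantLimit → 7⁗ → PlantedPinning.MoebiusLimitExists`. [cite: DuminilCopinICM2022, §8.4] -/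
theorem plantedPinning_MoebiusLimitExists_of_existence_of_k1WardStrict
    (hE : HyperoctahedralRP.ExistsScaleCovariantLimit)
    (h7 : ∀ (ρ : ℝ → ℝ) (Δ : ℝ) (S : CorrFamily 3), (∀ δ ∈ Set.Ioc (0:ℝ) 1, 0 < ρ δ) →
      HasPointwiseScalingLimit (criticalCorr 3) ρ S → (∀ n z, z ∉ NonCoincident 3 n → S n z = 0) →
      IsNondegenerateTwoPoint S → IsEuclideanInvariant S → IsScaleCovariant Δ S →
      1 / 2 < Δ → Δ ≤ 3 / 4 → HasNontrivialU4 S →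
      (∀ τ : Fin 3, PointwiseOSReconstruction τ S) →
      (∀ (n m : ℕ) (x : Fin n → EuclideanSpace ℝ (Fin 3)) (y : Fin m → EuclideanSpace ℝ (Fin 3))
        (v : EuclideanSpace ℝ (Fin 3)), v ≠ 0 →
        Tendsto (fun t : ℝ => S (n + m) (Fin.append x (fun j => y j + t • v)) - S n x * S m y)
          atTop (𝓝 0)) →
      ∀ n, 4 ≤ n → Even n → ∀ (φ : (Fin n → EuclideanSpace ℝ (Fin 3)) → ℝ),
        ContDiff ℝ ((⊤ : ℕ∞) : WithTop ℕ∞) φ → HasCompactSupport φ → tsupport φ ⊆ NonCoincident 3 n →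
        ∫ x, S n x * ((2 * Δ - 6) * (∑ i, inner ℝ (EuclideanSpace.single 0 1 : EuclideanSpace ℝ (Fin 3)) (x i)) * φ x +
          fderiv ℝ φ x (fun i => ‖x i‖ ^ 2 • (EuclideanSpace.single 0 1 : EuclideanSpace ℝ (Fin 3)) -
            (2 * inner ℝ (EuclideanSpace.single 0 1 : EuclideanSpace ℝ (Fin 3)) (x i)) • x i)) = 0) :
    PlantedPinning.MoebiusLimitExists :=
  MoebiusLimitExists_of_existence_of_k1WardStrict hE h7

/-- Route LeeYangGap: `ExistsScaleCovariantLimit → 7⁗ → LeeYangGap.MoebiusLimitExists`. [cite: DuminilCopinICM2022, §8.4] -/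
theorem leeYangGap_MoebiusLimitExists_of_existence_of_k1WardStrict
    (hE : HyperoctahedralRP.ExistsScaleCovariantLimit)
    (h7 : ∀ (ρ : ℝ → ℝ) (Δ : ℝ) (S : CorrFamily 3), (∀ δ ∈ Set.Ioc (0:ℝ) 1, 0 < ρ δ) →
      HasPointwiseScalingLimit (criticalCorr 3) ρ S → (∀ n z, z ∉ NonCoincident 3 n → S n z = 0) →
      IsNondegenerateTwoPoint S → IsEuclideanInvariant S → IsScaleCovariant Δ S →
      1 / 2 < Δ → Δ ≤ 3 / 4 → HasNontrivialU4 S →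
      (∀ τ : Fin 3, PointwiseOSReconstruction τ S) →
      (∀ (n m : ℕ) (x : Fin n → EuclideanSpace ℝ (Fin 3)) (y : Fin m → EuclideanSpace ℝ (Fin 3))
        (v : EuclideanSpace ℝ (Fin 3)), v ≠ 0 →
        Tendsto (fun t : ℝ => S (n + m) (Fin.append x (fun j => y j + t • v)) - S n x * S m y)
          atTop (𝓝 0)) →
      ∀ n, 4 ≤ n → Even n → ∀ (φ : (Fin n → EuclideanSpace ℝ (Fin 3)) → ℝ),
        ContDiff ℝ ((⊤ : ℕ∞) : WithTop ℕ∞) φ → HasCompactSupport φ → tsupport φ ⊆ NonCoincident 3 n →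
        ∫ x, S n x * ((2 * Δ - 6) * (∑ i, inner ℝ (EuclideanSpace.single 0 1 : EuclideanSpace ℝ (Fin 3)) (x i)) * φ x +
          fderiv ℝ φ x (fun i => ‖x i‖ ^ 2 • (EuclideanSpace.single 0 1 : EuclideanSpace ℝ (Fin 3)) -
            (2 * inner ℝ (EuclideanSpace.single 0 1 : EuclideanSpace ℝ (Fin 3)) (x i)) • x i)) = 0) :
    LeeYangGap.MoebiusLimitExists :=
  MoebiusLimitExists_of_existence_of_k1WardStrict hE h7

/-- Route SubPtolemyInterlacing (decl `MoebiusLimit`): `ExistsScaleCovariantLimit → 7⁗ → SubPtolemyInterlacing.MoebiusLimit`.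
[cite: DuminilCopinICM2022, §8.4] -/
theorem subPtolemyInterlacing_MoebiusLimit_of_existence_of_k1WardStrict
    (hE : HyperoctahedralRP.ExistsScaleCovariantLimit)
    (h7 : ∀ (ρ : ℝ → ℝ) (Δ : ℝ) (S : CorrFamily 3), (∀ δ ∈ Set.Ioc (0:ℝ) 1, 0 < ρ δ) →
      HasPointwiseScalingLimit (criticalCorr 3) ρ S → (∀ n z, z ∉ NonCoincident 3 n → S n z = 0) →
      IsNondegenerateTwoPoint S → IsEuclideanInvariant S → IsScaleCovariant Δ S →
      1 / 2 < Δ → Δ ≤ 3 / 4 → HasNontrivialU4 S →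
      (∀ τ : Fin 3, PointwiseOSReconstruction τ S) →
      (∀ (n m : ℕ) (x : Fin n → EuclideanSpace ℝ (Fin 3)) (y : Fin m → EuclideanSpace ℝ (Fin 3))
        (v : EuclideanSpace ℝ (Fin 3)), v ≠ 0 →
        Tendsto (fun t : ℝ => S (n + m) (Fin.append x (fun j => y j + t • v)) - S n x * S m y)
          atTop (𝓝 0)) →
      ∀ n, 4 ≤ n → Even n → ∀ (φ : (Fin n → EuclideanSpace ℝ (Fin 3)) → ℝ),
        ContDiff ℝ ((⊤ : ℕ∞) : WithTop ℕ∞) φ → HasCompactSupport φ → tsupport φ ⊆ NonCoincident 3 n →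
        ∫ x, S n x * ((2 * Δ - 6) * (∑ i, inner ℝ (EuclideanSpace.single 0 1 : EuclideanSpace ℝ (Fin 3)) (x i)) * φ x +
          fderiv ℝ φ x (fun i => ‖x i‖ ^ 2 • (EuclideanSpace.single 0 1 : EuclideanSpace ℝ (Fin 3)) -
            (2 * inner ℝ (EuclideanSpace.single 0 1 : EuclideanSpace ℝ (Fin 3)) (x i)) • x i)) = 0) :
    SubPtolemyInterlacing.MoebiusLimit :=
  MoebiusLimitExists_of_existence_of_k1WardStrict hE h7

/-- Route EnergyNotSigmaSquared (decl `MoebiusLimit`): `ExistsScaleCovariantLimit → 7⁗ → EnergyNotSigmaSquared.MoebiusLimit`.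
[cite: DuminilCopinICM2022, §8.4] -/
theorem energyNotSigmaSquared_MoebiusLimit_of_existence_of_k1WardStrict
    (hE : HyperoctahedralRP.ExistsScaleCovariantLimit)
    (h7 : ∀ (ρ : ℝ → ℝ) (Δ : ℝ) (S : CorrFamily 3), (∀ δ ∈ Set.Ioc (0:ℝ) 1, 0 < ρ δ) →
      HasPointwiseScalingLimit (criticalCorr 3) ρ S → (∀ n z, z ∉ NonCoincident 3 n → S n z = 0) →
      IsNondegenerateTwoPoint S → IsEuclideanInvariant S → IsScaleCovariant Δ S →
      1 / 2 < Δ → Δ ≤ 3 / 4 → HasNontrivialU4 S →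
      (∀ τ : Fin 3, PointwiseOSReconstruction τ S) →
      (∀ (n m : ℕ) (x : Fin n → EuclideanSpace ℝ (Fin 3)) (y : Fin m → EuclideanSpace ℝ (Fin 3))
        (v : EuclideanSpace ℝ (Fin 3)), v ≠ 0 →
        Tendsto (fun t : ℝ => S (n + m) (Fin.append x (fun j => y j + t • v)) - S n x * S m y)
          atTop (𝓝 0)) →
      ∀ n, 4 ≤ n → Even n → ∀ (φ : (Fin n → EuclideanSpace ℝ (Fin 3)) → ℝ),
        ContDiff ℝ ((⊤ : ℕ∞) : WithTop ℕ∞) φ → HasCompactSupport φ → tsupport φ ⊆ NonCoincident 3 n →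
        ∫ x, S n x * ((2 * Δ - 6) * (∑ i, inner ℝ (EuclideanSpace.single 0 1 : EuclideanSpace ℝ (Fin 3)) (x i)) * φ x +
          fderiv ℝ φ x (fun i => ‖x i‖ ^ 2 • (EuclideanSpace.single 0 1 : EuclideanSpace ℝ (Fin 3)) -
            (2 * inner ℝ (EuclideanSpace.single 0 1 : EuclideanSpace ℝ (Fin 3)) (x i)) • x i)) = 0) :
    EnergyNotSigmaSquared.MoebiusLimit :=
  MoebiusLimitExists_of_existence_of_k1WardStrict hE h7

end Summit.CriticalPhenomena.Ising3DConformalLimit.MoebiusLimitExistsK1Door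

end
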